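import Summits.CriticalPhenomena.PercolationContinuityZ3.Theorems.PercNearOneGluingNoHeavyLowerTailSahiSharedTwoPointIdentity
import Mathlib.Tactic.Linarith
import Mathlib.Tactic.Ring
import Mathlib.Tactic.FieldSimp
import HarnessLib

/-!
# `NoHeavyLowerTail` (crux stmt-CriticalPhenomena-4575), P2 — the pointwise kernel `Φ_ρ ≥ 0` on a CHAIN from the ratio condition `(⋆)` (part A of THEOREM C)

Memo SAHI-ROUTE.md §4.29(b),(c) (seat `prim-masterthm-p2`, gen 8; `--supports stmt-CriticalPhenomena-4575`).  No `sorry`, standard axioms.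

For the ratio family of `…SahiSharedTwoPointIdentity` (`sahiE_three_eq_of_ratio`): `E_3 = E_b[Φ_r + Δ_r] + covpart_r` with
`Φ_r(b) = Σ_c wC(c)[g_b(c)((2−r_c)Y_b(c) − EF·H_b(c)) − G(b)(1−r_c)Y_b(c)]`.  THIS FILE: when the block `γ` shared by `f` and `g` is TOTALLY ORDERED,
`Φ_r(b) ≥ 0` for every ratio `0 ≤ r ≤ 1` satisfying `(⋆) F(c') ≤ (1 − r_c + r_{c'})F(c)` for `c' ≤ c` — with NO coupling argument: writing `Σ_c wC = 1`,
`Φ_r = Σ_i Σ_j wC(i)wC(j) T(i,j)`, `T(i,j) = g_i(2−r_i)Y_i − g_iF_jH_i − g_j(1−r_i)Y_i`, and for a comparable pair `j ≤ i`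
`T(i,j) + T(j,i) = (g_i − g_j)·[(2−r_i)Y_i − F_jH_i − (1−r_j)Y_j] + g_j·[Y_i + Y_j − F_jH_i − F_iH_j] ≥ 0`
(the first bracket is the MARGIN, `≥ ((1−r_i+r_j)F_i − F_j)H_i ≥ 0` by `(⋆)`; the second is `≥ (F_i − F_j)(H_i − H_j) ≥ 0`).  On a chain every pair is comparable.
The lemma is stated abstractly (slice data `gb, Yb, Hb`, environment `F, r`), then specialised to `PhiOf`.
-/

noncomputable section

open scoped Classical

namespace Summit.CriticalPhenomena.PercolationContinuityZ3.Theorems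

namespace SahiSharedChain

open Finset
open Literature.Combinatorics.Sahi2008
open SahiSharedTwoPoint (Y FC HH GG EF PhiOf)

section Abstract

variable {γ : Type} [Fintype γ] [LinearOrder γ]

/-- The pair term `T(i,j) = g_i(2−r_i)Y_i − g_i F_j H_i − g_j (1−r_i) Y_i`. [this work] -/
def pairT (gb Yb Hb F r : γ → ℝ) (i j : γ) : ℝ :=
  gb i * ((2 - r i) * Yb i) - gb i * (F j * Hb i) - gb j * ((1 - r i) * Yb i)

omit [Fintype γ] in
/-- The symmetrised pair term is nonnegative for a comparable pair `j ≤ i` (margin + rearrangement). [this work] -/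
theorem pairT_add_pairT_nonneg {gb Yb Hb F r : γ → ℝ} (hg0 : ∀ c, 0 ≤ gb c) (hg : Monotone gb)
    (hH0 : ∀ c, 0 ≤ Hb c) (hH : Monotone Hb) (hF : Monotone F) (hY : Monotone Yb)
    (hFH : ∀ c, F c * Hb c ≤ Yb c) (hr0 : ∀ c, 0 ≤ r c) (hr1 : ∀ c, r c ≤ 1)
    (hstar : ∀ c c', c' ≤ c → F c' ≤ (1 - r c + r c') * F c) {i j : γ} (hji : j ≤ i) :
    0 ≤ pairT gb Yb Hb F r i j + pairT gb Yb Hb F r j i := by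
  have hgij : gb j ≤ gb i := hg hji
  have hYij : Yb j ≤ Yb i := hY hji
  have hFij : F j ≤ F i := hF hji
  have hHij : Hb j ≤ Hb i := hH hji
  -- the margin M = (2 − r_i) Y_i − F_j H_i − (1 − r_j) Y_j ≥ 0
  have hc : 0 ≤ 1 - r i + r j := by linarith [hr1 i, hr0 j]
  have m1 : (1 - r j) * Yb j ≤ (1 - r j) * Yb i := mul_le_mul_of_nonneg_left hYij (by linarith [hr1 j])
  have m2 : (1 - r i + r j) * (F i * Hb i) ≤ (1 - r i + r j) * Yb i := mul_le_mul_of_nonneg_left (hFH i) hc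
  have m3 : F j * Hb i ≤ (1 - r i + r j) * F i * Hb i := mul_le_mul_of_nonneg_right (hstar i j hji) (hH0 i)
  have hM : 0 ≤ (2 - r i) * Yb i - F j * Hb i - (1 - r j) * Yb j := by nlinarith [m1, m2, m3]
  -- the rearrangement term R = Y_i + Y_j − F_j H_i − F_i H_j ≥ (F_i − F_j)(H_i − H_j) ≥ 0
  have hR : 0 ≤ Yb i + Yb j - F j * Hb i - F i * Hb j := by
    nlinarith [hFH i, hFH j, mul_nonneg (sub_nonneg.mpr hFij) (sub_nonneg.mpr hHij)]
  have e : pairT gb Yb Hb F r i j + pairT gb Yb Hb F r j i =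
      (gb i - gb j) * ((2 - r i) * Yb i - F j * Hb i - (1 - r j) * Yb j) + gb j * (Yb i + Yb j - F j * Hb i - F i * Hb j) := by
    unfold pairT; ring
  rw [e]
  exact add_nonneg (mul_nonneg (sub_nonneg.mpr hgij) hM) (mul_nonneg (hg0 j) hR)

/-- **`Φ ≥ 0` on a chain from `(⋆)`** (abstract form).  `γ` a finite linear order, `w ≥ 0` with `Σ w = 1`; slice data `gb, Hb ≥ 0` monotone, `Yb` monotone with
`F·Hb ≤ Yb`; environment `F` monotone, ratio `0 ≤ r ≤ 1` with `(⋆)`.  Then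
`Σ_c w(c)[gb(c)((2−r_c)Yb(c) − (Σ wF)·Hb(c)) − (Σ w gb)(1−r_c)Yb(c)] ≥ 0`. [this work] -/
theorem phi_nonneg_chain {w gb Yb Hb F r : γ → ℝ} (hw0 : ∀ c, 0 ≤ w c) (hw1 : ∑ c, w c = 1)
    (hg0 : ∀ c, 0 ≤ gb c) (hg : Monotone gb) (hH0 : ∀ c, 0 ≤ Hb c) (hH : Monotone Hb) (hF : Monotone F)
    (hY : Monotone Yb) (hFH : ∀ c, F c * Hb c ≤ Yb c) (hr0 : ∀ c, 0 ≤ r c) (hr1 : ∀ c, r c ≤ 1)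
    (hstar : ∀ c c', c' ≤ c → F c' ≤ (1 - r c + r c') * F c) :
    0 ≤ (∑ c, w c * (gb c * ((2 - r c) * Yb c - (∑ c', w c' * F c') * Hb c) - (∑ c', w c' * gb c') * ((1 - r c) * Yb c))) := by
  -- Φ = Σ_i Σ_j w_i w_j T(i,j)
  have e1 : (∑ c, w c * (gb c * ((2 - r c) * Yb c - (∑ c', w c' * F c') * Hb c) - (∑ c', w c' * gb c') * ((1 - r c) * Yb c))) =
      ∑ i, ∑ j, w i * w j * pairT gb Yb Hb F r i j := by
    refine sum_congr rfl fun i _ => ?_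
    have h2 : w i * (gb i * ((2 - r i) * Yb i)) = ∑ j, w i * w j * (gb i * ((2 - r i) * Yb i)) := by
      rw [← sum_mul, ← mul_sum, hw1, mul_one]
    have h3 : w i * (gb i * ((∑ c', w c' * F c') * Hb i)) = ∑ j, w i * w j * (gb i * (F j * Hb i)) := by
      have : w i * (gb i * ((∑ c', w c' * F c') * Hb i)) = (w i * gb i * Hb i) * ∑ j, w j * F j := by ring
      rw [this, mul_sum]
      exact sum_congr rfl fun j _ => by ring
    have h4 : w i * ((∑ c', w c' * gb c') * ((1 - r i) * Yb i)) = ∑ j, w i * w j * (gb j * ((1 - r i) * Yb i)) := by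
      rw [sum_mul, mul_sum]
      exact sum_congr rfl fun j _ => by ring
    have e : w i * (gb i * ((2 - r i) * Yb i - (∑ c', w c' * F c') * Hb i) - (∑ c', w c' * gb c') * ((1 - r i) * Yb i)) =
        w i * (gb i * ((2 - r i) * Yb i)) - w i * (gb i * ((∑ c', w c' * F c') * Hb i)) -
          w i * ((∑ c', w c' * gb c') * ((1 - r i) * Yb i)) := by ring
    rw [e, h2, h3, h4, ← sum_sub_distrib, ← sum_sub_distrib]
    exact sum_congr rfl fun j _ => by unfold pairT; ring
  -- symmetrise
  have e2 : (∑ i, ∑ j, w i * w j * pairT gb Yb Hb F r i j) =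
      (1 / 2) * ∑ i, ∑ j, w i * w j * (pairT gb Yb Hb F r i j + pairT gb Yb Hb F r j i) := by
    have hsym : (∑ i, ∑ j, w i * w j * pairT gb Yb Hb F r i j) = ∑ i, ∑ j, w i * w j * pairT gb Yb Hb F r j i := by
      rw [sum_comm]
      exact sum_congr rfl fun i _ => sum_congr rfl fun j _ => by ring
    have hsplit : (∑ i, ∑ j, w i * w j * (pairT gb Yb Hb F r i j + pairT gb Yb Hb F r j i)) =
        (∑ i, ∑ j, w i * w j * pairT gb Yb Hb F r i j) + ∑ i, ∑ j, w i * w j * pairT gb Yb Hb F r j i := by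
      rw [← sum_add_distrib]
      exact sum_congr rfl fun i _ => by rw [← sum_add_distrib]; exact sum_congr rfl fun j _ => by ring
    rw [hsplit, ← hsym]; ring
  rw [e1, e2]
  refine mul_nonneg (by norm_num) (sum_nonneg fun i _ => sum_nonneg fun j _ => mul_nonneg (mul_nonneg (hw0 i) (hw0 j)) ?_)
  rcases le_total j i with hji | hij
  · exact pairT_add_pairT_nonneg hg0 hg hH0 hH hF hY hFH hr0 hr1 hstar hji
  · rw [add_comm]; exact pairT_add_pairT_nonneg hg0 hg hH0 hH hF hY hFH hr0 hr1 hstar hij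

end Abstract

section Slices

variable {α β γ : Type} [Fintype α] [Fintype β] [Fintype γ] [LinearOrder γ]
  {wA : α → ℝ} {wB : β → ℝ} {wC : γ → ℝ} {f : γ → α → ℝ} {g : γ → β → ℝ} {h : γ → α → β → ℝ} {r : γ → ℝ}

omit [Fintype β] in
/-- **`Φ_r(b) ≥ 0` on a chain** for the ratio-family kernel `PhiOf` of `…SahiSharedTwoPointIdentity`: `γ` totally ordered, `wC ≥ 0` with `Σ wC = 1`,
`wA` an FKG probability weight on `α`, `f, g, h ≥ 0` coordinatewise monotone, `0 ≤ r ≤ 1` with `(⋆) F(c') ≤ (1 − r_c + r_{c'})F(c)` (`F = FC`). [this work] -/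
theorem PhiOf_nonneg_chain [DistribLattice α] (hA : IsFKGMeasure wA) (hC0 : ∀ c, 0 ≤ wC c) (hC1 : ∑ c, wC c = 1)
    (hf0 : ∀ c a, 0 ≤ f c a) (hfa : ∀ c, Monotone (f c)) (hfc : ∀ a, Monotone (fun c => f c a))
    (hg0 : ∀ c b, 0 ≤ g c b) (hgc : ∀ b, Monotone (fun c => g c b))
    (hh0 : ∀ c a b, 0 ≤ h c a b) (hhc : ∀ a b, Monotone (fun c => h c a b)) (hha : ∀ c b, Monotone (fun a => h c a b))
    (hr0 : ∀ c, 0 ≤ r c) (hr1 : ∀ c, r c ≤ 1)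
    (hstar : ∀ c c', c' ≤ c → FC wA f c' ≤ (1 - r c + r c') * FC wA f c) (b : β) :
    0 ≤ PhiOf wA wC f g h r b := by
  have hA0 := hA.nonneg
  unfold PhiOf EF GG
  refine phi_nonneg_chain (gb := fun c => g c b) (Yb := fun c => Y wA f h c b) (Hb := fun c => HH wA h c b) (F := FC wA f)
    hC0 hC1 (fun c => hg0 c b) (hgc b) ?_ ?_ ?_ ?_ ?_ hr0 hr1 hstar
  · exact fun c => sum_nonneg fun a _ => mul_nonneg (hA0 a) (hh0 c a b)
  · exact fun c c' hcc => sum_le_sum fun a _ => mul_le_mul_of_nonneg_left (hhc a b hcc) (hA0 a)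
  · exact fun c c' hcc => sum_le_sum fun a _ => mul_le_mul_of_nonneg_left (hfc a hcc) (hA0 a)
  · exact fun c c' hcc => sum_le_sum fun a _ => mul_le_mul_of_nonneg_left
      (mul_le_mul (hfc a hcc) (hhc a b hcc) (hh0 c a b) (hf0 c' a)) (hA0 a)
  · intro c
    unfold FC HH Y
    exact SahiTriangleSupermodular.fkg_sum hA (hf0 c) (fun a => hh0 c a b) (hfa c) (hha c b)

end Slices

end SahiSharedChain

end Summit.CriticalPhenomena.PercolationContinuityZ3.Theorems
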